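/-
Copyright: seat `ym-line-sll-p5` (prover-ym-line-sll-p5-g0-0), route `SoftLoopLongLag`, crux `SoftLoopLagFloorToTorus`
(stmt-QuantumFields-22504), line `birth` (skeleton `Cruxes/SoftLoopLagFloorToTorus/Lines/birth.lean`, v3), stub K2 `stub_meanSmoothG`.
-/
import Summits.QuantumFields.YangMills.Theorems.SoftLoopLongLagInnerMeanSmoothLoopBricks
import Summits.QuantumFields.YangMills.Theorems.SoftLoopLongLagLoopTranslation
import Summits.QuantumFields.YangMills.Theorems.ColdBoxAllGroupsDefs
import Literature.MathematicalPhysics.QuantumFieldTheory.BalabanBlockSpecification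

/-!
# Crux `SoftLoopLagFloorToTorus` (stmt-QuantumFields-22504), line `birth`, stub K2 `stub_meanSmoothG` — the E2 REDUCTION LAYER:
# inner-datum mean smoothness of the cube-smeared soft loops on the `ColdBoxAllGroups` geometry ⇐ a one-scale LOOP kernel-mean
# expansion (N2-loops, unfolded; the interface shared with sll-p4's reduction) + the G-free bricks, with UNIFORM constants (registered shape)

WHAT.  The registered stub K2 `stub_meanSmoothG` of the K′ skeleton (`Cruxes/SoftLoopLagFloorToTorus/Lines/birth.lean` v3) — same-datum
conditional-mean smoothness over lag `R` of the soft-loop sum — is planned (lead `ym-line-sll-p1`, WAKE-sll-p3 wave 3; T′ rev 3 =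
stmt-QuantumFields-24180) as «E2 (inner-datum mean smoothness on the sibling route's box `{0,…,2H}⁴`, kernel `ColdBoxAllGroups.boxKernelG`)
+ the in-box DLR mixture for means».  This file is the kernel-checked REDUCTION of E2 to a one-scale LOOP kernel-mean expansion, the loop
analogue of `ColdBoxAllGroups.goodBoundaryMeanSmoothG_of_expansion_explicit` (L1b-G ⇐ N2-G ∧ N1′, plaquettes), for EVERY compact `G`:

* `innerDatumMeanSmoothG_registered_of_loopMeanExpansion` — the body of the REGISTERED stub `stub_innerDatumMeanSmoothG` (K′ skeleton v5 =
  T′ skeleton v6, shared E2; constants `K, a₂, κ₂` uniform in `ε, a, κ`) for `(G, r)` from a UNIFORM N2-loops (one `CE` along `4ε ≤ a ≤ a₂`,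
  `κ ≤ κ₂`) — what the width seat sll-p4's reduction `innerDatumMeanSmoothG_of_loopMeanExpansion` (general `Good`, `∃ K` per exponent triple)
  does not give by itself; one line from:
* `innerMeanSmoothLoopG_of_loopMeanExpansion` — there is an absolute `K₀ > 0` such that for all `G`, `r`, `0 < ε < a`, `0 < κ`, `CE`:
  IF (N2-loops — the SAME inline interface as the width seat sll-p4's `SoftLoopLongLagInnerMeanSmoothOfExpansionG`, `Good` instantiated, `b = a`,
  `δ = κ/2`; nothing new is defined) for `β ≥ β₀` and every inner datum `ζ` with `CrudeGoodG r.ρ β (κ/2) H ζ` (`H = ⌈β^a⌉`)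
  whose kernel charges the inner hot event `(coldEvent r β κ (boxEdges 4 (2H+1)))ᶜ` by `≤ e^{−β^{κ/8}}` there are one-colour Dirichlet data
  `ϑ c` and free competitors `s c` (`c < D = dimE r.ρ`) of total Maxwell energy `≤ CE·(2H+3)⁴·β^{2(κ/2)−1}` (exactly the data of
  `ColdBoxAllGroups.KernelMeanExpansionG`) such that at every base point `x` with `‖x − boxCentre H‖ + R ≤ H/8` the kernel mean of the `R×R`
  loop COST (`R = ⌈β^ε⌉`, `ℓ_x = rectWalk x 1 2 R R`) is the Gaussian value up to `β^{−a}`,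
  `|β·E_ζ[N − Re tr r(hol_{ℓ_x})] − (D/2)·V_D(ℓ_x) − β·Σ_c Φ̄_c(ℓ_x)²| ≤ β^{−a}`, with the loop Dirichlet variance
  `V_D(ℓ_y) = Σ_{p,q ∈ rectSurface y R R} boxDirProjKernel H p q` and the background fluxes `Φ̄_c(ℓ_y) = Σ_{p ∈ rectSurface y R R} F̄_c(p)`,
  `F̄_c = sCirc (glue (ϑ c) (mean (ϑ c)))` (linearity + lattice Stokes of the plaquette formula; Wick for the quadratic loop cost),
  THEN (E2) for `β ≥ β₀'`, the same data `ζ` and `F_H = softLoopObs r R ∘ configShift (−boxCentre H)`: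
  `|E_ζ[F_H ∘ α_R] − E_ζ[F_H]| ≤ K₀·(D+1)·(|CE|+1)·R⁸·β^{κ−1}/H`.
* Brick (i) `abs_loopDirVariance_shift_sub_le` (G-free): `|V_D(ℓ_{y+v}) − V_D(ℓ_y)| ≤ 2K·R⁴/H⁴` near the centre, from the LANDED two-plaquette
  comparison `exists_boxDirProjKernel_sub_curl_bound` (Dirichlet kernel = `ℤ⁴` curl kernel `± K/H⁴`) and `curl_greenTensor_shift`.
* Brick (ii) `abs_sum_surfaceFluxSq_sub_le` (G-free): the background term telescoped over `T` unit time steps,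
  `|Σ_c Φ̄_c(T)² − Σ_c Φ̄_c(0)²| ≤ T·2R⁴·(Σ_c S_c²)/H⁵` from interior sup `S_c/H²` and time-gradient `S_c/H³` bounds — for the Dirichlet
  background these are the LANDED `dirBackground_interior_bounds` (`S_c = C·√E_c`).
* Plumbing: the translated soft-loop sums and their means loop by loop are the width seat sll-p4's `SoftLoopLongLagLoopTranslation`
  (`integral_softLoopObs_configShift_neg(_timeShiftLG)`, `card_timeZeroCube_le_real`); the bricks file `SoftLoopLongLagInnerMeanSmoothLoopBricks`
  supplies `near_centre_cube` and the pure arithmetic `loopMean_assembly_le` / `loopMean_exponent_arith`; here `perLoop_meanDiff_le` (per loop: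
  `2β^{−a} ≤ 4/H`, `(D/2)·2K R⁴/H⁴`, `β·R·2R⁴C²|CE|·625H⁴β^{κ−1}/H⁵`; `K₀ = 27·(4 + K + 1250·C²)`, thresholds `β ≥ 1`, `β^a ≥ 32`,
  `β^{a−ε} ≥ 48` so that `H ≥ 32`, `24R ≤ H`).

WHY the window closes: the transfer K1⁺⁺ (`dlrTransferG_of_goodFloor_of_smooth`, LANDED) needs the squared mean difference `¼(Δm)²` below the
floor `(c/8)R³β^{−2}`, i.e. `R¹³β^{2κ} ≪ H²` — with the registered inner exponent `H = β^{31ε/4}` and `κ ≤ ε` this is `13ε + 2κ < 31ε/2` ✓.  N2-loops is the loop version of the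
OPEN engine stub N2-G of crux `BulkAllGroups` (stmt-QuantumFields-22255, `stub_kernelMeanExpansionG`; bricks `SoftLoopLongLagLoopCostCubic`,
`…OneScaleDefs`, `…ExpChartPackage2*`) — import, never re-port; if the engine delivers the loop expansion in a different dress (conditioned kernel,
other error budget) only `innerMeanSmoothLoopG_of_loopMeanExpansion` is re-cut, bricks (i)–(ii) are independent of it.

HONEST LABEL: rung R2xi-G RECORD label (leaf `WeakCouplingRates.XiPow`, an UPPER bound on the lattice mass gap for every compact simple `G`);
NOT the Clay mass gap; no summit statement is touched.  No new definition; standard axioms; no `sorry`.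

References: T. Balaban, CMP 109 (1987) §1 (small-field expansions with boundary conditions); H.-O. Georgii, *Gibbs Measures and Phase
Transitions* (2011) (5.3) (translations); G. Lawler, *Intersections of Random Walks* (1991) §1.5 (Green function asymptotics); S. Chatterjee,
arXiv:1803.01950 §4 (Wilson loops, lattice Stokes).
-/

set_option autoImplicit false

noncomputable section

open MeasureTheory Finset
open Literature.Probability.LatticeModels (Site box mem_box)
open Literature.MathematicalPhysics Literature.MathematicalPhysics.QuantumFieldTheory
open Literature.MathematicalPhysics.QuantumLattice
open Literature.MathematicalPhysics.QuantumFieldTheory.LatticeMaxwell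
open Literature.MathematicalPhysics.QuantumFieldTheory.AxialGauge
open Literature.MathematicalPhysics.QuantumFieldTheory.LatticeChain
open Literature.MathematicalPhysics.QuantumFieldTheory.LatticeForm (e d₁)
open Summit.QuantumFields.YangMills.Theorems.WeakCouplingRates
open Summit.QuantumFields.YangMills.Theorems.ColdBoxAllGroups (boxKernelG CrudeGoodG)
open Summit.QuantumFields.YangMills.Theorems.FreeEnergyLogCoefficient (dimE)

namespace Summit.QuantumFields.YangMills.Theorems.SoftLoopLongLag

/-- **The per-loop bound, abstract form** (G-free, measure-free): for one loop of the cube (base `x + centre`, `x ∈ timeZeroCube R`,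
`16R ≤ H`), the loop-mean expansion at the two base points (`hexp`, error `β^{−a}`), the flat loop variance (`hV`, brick (i)) and the
interior sup/gradient bounds of the background plaquette functions `Fb c` (`hsup`, `hgrad`, energies `Ec c` of total size
`≤ |CE|·625H⁴·β^{κ−1}`) give `N·|Em(ℓ + R e₀) − Em(ℓ)| ≤ (4 + K + 1250C²)(D+1)(|CE|+1)·R⁵β^{κ−1}/H`. -/
theorem perLoop_meanDiff_le {D : ℕ} {β a κ K C CE N : ℝ} {R H : ℕ} (Em V : Site 4 → ℝ) (Fb : Fin D → Site 4 → ℝ)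
    (Ec : Fin D → ℝ) (hβ1 : 1 ≤ β) (hκ : 0 < κ) (hK0 : 0 ≤ K) (hN : 0 ≤ N)
    (hR1 : (1 : ℝ) ≤ R) (hH1 : (1 : ℝ) ≤ H) (hH2 : (H : ℝ) ≤ 2 * β ^ a) (h24 : 24 * R ≤ H)
    (hEc0 : ∀ c, 0 ≤ Ec c) (hEsum : ∑ c, Ec c ≤ |CE| * (625 * (H : ℝ) ^ 4) * β ^ (κ - 1))
    (hexp : ∀ y : Site 4, ‖y - boxCentre H‖ + R ≤ (H : ℝ) / 8 →
      |β * (N - N * Em y) - (D : ℝ) / 2 * V y - β * ∑ c, (∑ p ∈ rectSurface y R R, Fb c p.1) ^ 2| ≤ β ^ (-a))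
    (hV : ∀ y v : Site 4,
      (∀ a' b' : ℕ, a' < R → b' < R → ‖y + Pi.single 1 (a' : ℤ) + Pi.single 2 (b' : ℤ) - boxCentre H‖ ≤ (H : ℝ) / 8) →
      (∀ a' b' : ℕ, a' < R → b' < R → ‖y + v + Pi.single 1 (a' : ℤ) + Pi.single 2 (b' : ℤ) - boxCentre H‖ ≤ (H : ℝ) / 8) →
      |V (y + v) - V y| ≤ 2 * K * (R : ℝ) ^ 4 / (H : ℝ) ^ 4)
    (hsup : ∀ (c : Fin D) (z : Site 4), (∀ m : Fin 4, 8 * |z m - (H : ℤ)| ≤ (H : ℤ)) →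
      |Fb c z| ≤ C * Real.sqrt (Ec c) / (H : ℝ) ^ 2)
    (hgrad : ∀ (c : Fin D) (z : Site 4), (∀ m : Fin 4, 8 * |z m - (H : ℤ)| ≤ (H : ℤ)) →
      |Fb c (z + Pi.single 0 1) - Fb c z| ≤ C * Real.sqrt (Ec c) / (H : ℝ) ^ 3)
    {x : Site 4} (hx : x ∈ timeZeroCube R) :
    N * |Em (x + boxCentre H + Pi.single 0 (R : ℤ)) - Em (x + boxCentre H)| ≤
      (4 + K + 1250 * C ^ 2) * ((D : ℝ) + 1) * (|CE| + 1) * ((R : ℝ) ^ 5 * β ^ (κ - 1) / (H : ℝ)) := by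
  have hβ0 : 0 < β := by linarith
  have h16 : 16 * R ≤ H := by omega
  set y₀ : Site 4 := x + boxCentre H with hy₀
  -- nearness of all the points involved
  have hnear : ∀ t a' b' : ℕ, t ≤ R → a' ≤ R → b' ≤ R → ∀ m : Fin 4,
      8 * |(y₀ + Pi.single 0 (t : ℤ) + Pi.single 1 (a' : ℤ) + Pi.single 2 (b' : ℤ) : Site 4) m - (H : ℤ)| ≤ (H : ℤ) :=
    fun t a' b' ht ha hb m => near_centre_cube h16 hx ht ha hb m
  have hnear' : ∀ t : ℕ, t ≤ R → ‖y₀ + Pi.single 0 (t : ℤ) - boxCentre H‖ + R ≤ (H : ℝ) / 8 := by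
    intro t ht
    have h1 : ‖y₀ + Pi.single 0 (t : ℤ) - boxCentre H‖ ≤ 2 * (R : ℝ) := norm_loopBase_sub_le hx (boxCentre H) ht
    have h2 : (24 : ℝ) * R ≤ H := by exact_mod_cast h24
    linarith
  -- the expansion at the two loops
  have e0 : |β * (N - N * Em y₀) - (D : ℝ) / 2 * V y₀ - β * ∑ c, (∑ p ∈ rectSurface y₀ R R, Fb c p.1) ^ 2| ≤ β ^ (-a) :=
    hexp y₀ (by simpa using hnear' 0 (Nat.zero_le R))
  have eT : |β * (N - N * Em (y₀ + Pi.single 0 (R : ℤ))) - (D : ℝ) / 2 * V (y₀ + Pi.single 0 (R : ℤ)) -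
      β * ∑ c, (∑ p ∈ rectSurface (y₀ + Pi.single 0 (R : ℤ)) R R, Fb c p.1) ^ 2| ≤ β ^ (-a) :=
    hexp _ (hnear' R le_rfl)
  -- brick (i): flatness of the loop variance
  have hflat : |V (y₀ + Pi.single 0 (R : ℤ)) - V y₀| ≤ 2 * K * (R : ℝ) ^ 4 / (H : ℝ) ^ 4 :=
    hV y₀ (Pi.single 0 (R : ℤ))
      (fun a' b' ha hb => norm_sub_boxCentre_le_of_int (by simpa using hnear 0 a' b' (Nat.zero_le R) ha.le hb.le))
      (fun a' b' ha hb => norm_sub_boxCentre_le_of_int (hnear R a' b' le_rfl ha.le hb.le))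
  -- brick (ii): the telescoped background
  have hback : |(∑ c, (∑ p ∈ rectSurface (y₀ + Pi.single 0 (R : ℤ)) R R, Fb c p.1) ^ 2) -
      (∑ c, (∑ p ∈ rectSurface y₀ R R, Fb c p.1) ^ 2)| ≤
        (R : ℝ) * (2 * (R : ℝ) ^ 4 * (∑ c, (C * Real.sqrt (Ec c)) ^ 2) / (H : ℝ) ^ 5) :=
    abs_sum_surfaceFluxSq_sub_le Fb (fun c => C * Real.sqrt (Ec c)) (H : ℝ) y₀ R R
      (fun c t a' b' ht ha hb => hsup c _ (hnear t a' b' ht ha.le hb.le))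
      (fun c t a' b' ht ha hb => hgrad c _ (hnear t a' b' (by omega) ha.le hb.le))
  have hS : ∑ c, (C * Real.sqrt (Ec c)) ^ 2 = C ^ 2 * ∑ c, Ec c := by
    rw [Finset.mul_sum]
    refine Finset.sum_congr rfl fun c _ => ?_
    rw [mul_pow, Real.sq_sqrt (hEc0 c)]
  rw [hS] at hback
  -- assemble and do the exponent bookkeeping
  have hmain := loopMean_assembly_le hβ0 hN (Nat.cast_nonneg D) e0 eT
  refine loopMean_exponent_arith hβ1 hR1 hH1 hH2 hκ hK0 (Nat.cast_nonneg D) hEsum (hmain.trans ?_)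
  gcongr

section Reduction

/-- On the spanning surface every plaquette is a `(1,2)`-plaquette: the two dresses `(p.1, p.2.1.1, p.2.1.2)` and `(p.1, 1, 2)` of a surface
plaquette as a `Plaq 4` agree. -/
theorem plaq_eq_of_mem_rectSurface {y : Site 4} {R T : ℕ} {p : ZdPlaquette 4} (hp : p ∈ rectSurface y R T) :
    ((p.1, p.2.1.1, p.2.1.2) : Plaq 4) = (p.1, 1, 2) := by
  unfold rectSurface at hp
  rw [Finset.mem_image] at hp
  obtain ⟨ab, -, rfl⟩ := hp
  rfl

/-- **E2 ⇐ N2-loops — inner-datum mean smoothness of the cube-smeared soft loops on the `ColdBoxAllGroups` geometry from a one-scale LOOP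
kernel-mean expansion**, for EVERY compact gauge group, with an ABSOLUTE constant (see the module docstring for the shapes).  There is `K₀ > 0` such
that for every `G`, `r`, exponents `0 < ε < a`, `0 < κ` and constant `CE`: IF (N2-loops, the interface of `SoftLoopLongLagInnerMeanSmoothOfExpansionG`
with `Good` = «crude-good at `κ/2` ∧ inner hot mass `≤ e^{−β^{κ/8}}`», `b = a`, `δ = κ/2`) for `β ≥ β₀` and every such inner datum `ζ` there are
one-colour Dirichlet data `ϑ c` and competitors `s c` (`c < dimE r.ρ`) of total Maxwell energy `≤ CE·(2H+3)⁴·β^{2(κ/2)−1}` (`H = ⌈β^a⌉`) such that at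
every base point `x` with `‖x − boxCentre H‖ + R ≤ H/8` (`R = ⌈β^ε⌉`) the kernel mean of the `R×R` loop COST is the Gaussian value up to `β^{−a}`,
`|β·E_ζ[N − Re tr r(hol_{ℓ_x})] − (D/2)·V_D(ℓ_x) − β·Σ_c Φ̄_c(ℓ_x)²| ≤ β^{−a}`, THEN (E2) for `β ≥ β₀'` and the same data,
`|E_ζ[F_H ∘ α_R] − E_ζ[F_H]| ≤ K₀·(D+1)·(|CE|+1)·R⁸·β^{κ−1}/H`, `F_H = softLoopObs r R ∘ configShift (−boxCentre H)`.
Proof: per loop (`perLoop_meanDiff_le`) the two expansion errors `2β^{−a} ≤ 4/H`, the flatness `(D/2)·2K R⁴/H⁴` (brick (i)) and the telescoped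
background `β·R·2R⁴·C²·(Σ_c E_c)/H⁵ ≤ 1250·C²·|CE|·R⁵β^κ/H` (brick (ii) with `dirBackground_interior_bounds`); divide by `β`, sum over the
`≤ 27R³` loops of the cube, divide by `N` (`N·∫W = N − ∫cost`; `N = 0` is trivial). [folklore] -/
theorem innerMeanSmoothLoopG_of_loopMeanExpansion : ∃ K₀ : ℝ, 0 < K₀ ∧
    ∀ (G : Type) [Group G] [TopologicalSpace G] [IsTopologicalGroup G] [CompactSpace G] [MeasurableSpace G] [BorelSpace G]
      (r : LatticeRep G) (ε a κ CE : ℝ), 0 < ε → ε < a → 0 < κ →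
      (∃ β₀ : ℝ, ∀ β : ℝ, β₀ ≤ β → ∀ ζ : LGConfig 4 G, CrudeGoodG r.ρ β (κ / 2) ⌈β ^ a⌉₊ ζ →
          boxKernelG r.ρ β ⌈β ^ a⌉₊ ζ (coldEvent r β κ (AxialGauge.boxEdges 4 (2 * ⌈β ^ a⌉₊ + 1)))ᶜ ≤
            ENNReal.ofReal (Real.exp (-(β ^ (κ / 8)))) →
          ∃ ϑ : Fin (dimE r.ρ) → (Literature.MathematicalPhysics.QuantumLattice.ZdEdge 4 → ℝ),
          ∃ s : Fin (dimE r.ρ) → (DirFree ⌈β ^ a⌉₊ → ℝ),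
            (∑ c, formM (fun e => e ∉ dirFreeEdges ⌈β ^ a⌉₊) dirCorner (2 * ⌈β ^ a⌉₊ + 3) (ϑ c) (s c) ≤
                CE * (2 * (⌈β ^ a⌉₊ : ℝ) + 3) ^ 4 * β ^ (2 * (κ / 2) - 1)) ∧
            ∀ x : Site 4, ‖x - boxCentre ⌈β ^ a⌉₊‖ + ⌈β ^ ε⌉₊ ≤ (⌈β ^ a⌉₊ : ℝ) / 8 →
              |β * (∫ U, ((r.N : ℝ) - (r.ρ (walkHolonomy U (rectWalk x 1 2 ⌈β ^ ε⌉₊ ⌈β ^ ε⌉₊))).trace.re)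
                    ∂(boxKernelG r.ρ β ⌈β ^ a⌉₊ ζ)) -
                  (dimE r.ρ : ℝ) / 2 * (∑ p ∈ rectSurface x ⌈β ^ ε⌉₊ ⌈β ^ ε⌉₊, ∑ q ∈ rectSurface x ⌈β ^ ε⌉₊ ⌈β ^ ε⌉₊,
                    boxDirProjKernel ⌈β ^ a⌉₊ ((p.1, p.2.1.1, p.2.1.2) : Plaq 4) ((q.1, q.2.1.1, q.2.1.2) : Plaq 4)) -
                  β * ∑ c, (∑ p ∈ rectSurface x ⌈β ^ ε⌉₊ ⌈β ^ ε⌉₊,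
                    sCirc (LatticeMaxwell.glue (pin := fun e => e ∉ dirFreeEdges ⌈β ^ a⌉₊) dirCorner (2 * ⌈β ^ a⌉₊ + 3)
                      (ϑ c) (mean (fun e => e ∉ dirFreeEdges ⌈β ^ a⌉₊) dirCorner (2 * ⌈β ^ a⌉₊ + 3) (ϑ c)))
                      ((p.1, p.2.1.1, p.2.1.2) : Plaq 4)) ^ 2| ≤ β ^ (-a)) →
      ∃ β₀ : ℝ, ∀ β : ℝ, β₀ ≤ β → ∀ ζ : LGConfig 4 G, CrudeGoodG r.ρ β (κ / 2) ⌈β ^ a⌉₊ ζ →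
          boxKernelG r.ρ β ⌈β ^ a⌉₊ ζ (coldEvent r β κ (AxialGauge.boxEdges 4 (2 * ⌈β ^ a⌉₊ + 1)))ᶜ ≤
            ENNReal.ofReal (Real.exp (-(β ^ (κ / 8)))) →
          |(∫ U, softLoopObs r ⌈β ^ ε⌉₊ (configShift (-(boxCentre ⌈β ^ a⌉₊)) (timeShiftLG (G := G) ⌈β ^ ε⌉₊ U))
                ∂(boxKernelG r.ρ β ⌈β ^ a⌉₊ ζ)) -
            (∫ U, softLoopObs r ⌈β ^ ε⌉₊ (configShift (-(boxCentre ⌈β ^ a⌉₊)) U) ∂(boxKernelG r.ρ β ⌈β ^ a⌉₊ ζ))|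
            ≤ K₀ * ((dimE r.ρ : ℝ) + 1) * (|CE| + 1) * (⌈β ^ ε⌉₊ : ℝ) ^ 8 * β ^ (κ - 1) / (⌈β ^ a⌉₊ : ℝ) := by
  obtain ⟨K, hK0, hK⟩ := abs_loopDirVariance_shift_sub_le
  obtain ⟨C, hC0, hI⟩ := dirBackground_interior_bounds
  refine ⟨27 * (4 + K + 1250 * C ^ 2), by positivity, ?_⟩
  intro G _ _ _ _ _ _ r ε a κ CE hε hεa hκ hexp
  obtain ⟨β₁, hE⟩ := hexp
  haveI : SecondCountableTopology G := LatticeRep.secondCountableTopology r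
  have ha : 0 < a := hε.trans hεa
  -- thresholds: `β ≥ β₁`, `β ≥ 1`, `β^a ≥ 32`, `β^{a-ε} ≥ 48`
  have hev1 : ∀ᶠ β : ℝ in Filter.atTop, (32 : ℝ) ≤ β ^ a := (tendsto_rpow_atTop ha).eventually_ge_atTop 32
  have hev2 : ∀ᶠ β : ℝ in Filter.atTop, (48 : ℝ) ≤ β ^ (a - ε) :=
    (tendsto_rpow_atTop (sub_pos.2 hεa)).eventually_ge_atTop 48
  obtain ⟨β₂, hβ₂⟩ := Filter.eventually_atTop.1 (hev1.and hev2)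
  refine ⟨max (max β₁ 1) β₂, fun β hβ ζ hζ htyp => ?_⟩
  have hβ₁ : β₁ ≤ β := le_trans (le_trans (le_max_left _ _) (le_max_left _ _)) hβ
  have hβ1 : (1 : ℝ) ≤ β := le_trans (le_trans (le_max_right _ _) (le_max_left _ _)) hβ
  have hβ0 : 0 < β := by linarith
  obtain ⟨h32, h48⟩ := hβ₂ β (le_trans (le_max_right _ _) hβ)
  -- sizes of `R = ⌈β^ε⌉`, `H = ⌈β^a⌉`
  obtain ⟨hR1, hR2⟩ := one_le_ceil_rpow_and_le hβ1 hε.le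
  obtain ⟨hH1, hH2⟩ := one_le_ceil_rpow_and_le hβ1 ha.le
  have hHge : β ^ a ≤ (⌈β ^ a⌉₊ : ℝ) := Nat.le_ceil _
  have hH32 : (32 : ℝ) ≤ (⌈β ^ a⌉₊ : ℝ) := h32.trans hHge
  have h24 : 24 * ⌈β ^ ε⌉₊ ≤ ⌈β ^ a⌉₊ := by
    have h1 : (24 : ℝ) * ⌈β ^ ε⌉₊ ≤ 48 * β ^ ε := by linarith
    have h2 : (48 : ℝ) * β ^ ε ≤ β ^ a := by
      have : β ^ a = β ^ (a - ε) * β ^ ε := by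
        rw [← Real.rpow_add hβ0]; ring_nf
      rw [this]
      exact mul_le_mul_of_nonneg_right h48 (Real.rpow_nonneg hβ0.le _)
    have : (24 : ℝ) * ⌈β ^ ε⌉₊ ≤ ⌈β ^ a⌉₊ := h1.trans (h2.trans hHge)
    exact_mod_cast this
  -- the expansion data for this `β`, `ζ`; then make `R`, `H` opaque
  obtain ⟨ϑ, s, henergy, hpt⟩ := hE β hβ₁ ζ hζ htyp
  clear hE hζ htyp
  generalize hRdef : ⌈β ^ ε⌉₊ = R at hpt hR1 hR2 h24 ⊢
  generalize hHdef : ⌈β ^ a⌉₊ = H at s henergy hpt hH1 hH2 hHge hH32 h24 ⊢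
  have hHpos : (0 : ℝ) < H := by linarith
  have hH8 : 8 ≤ H := by
    have : (8 : ℝ) ≤ H := by linarith
    exact_mod_cast this
  have hκ2 : 2 * (κ / 2) - 1 = κ - 1 := by ring
  rw [hκ2] at henergy
  -- notation
  set γ : Measure (LGConfig 4 G) := boxKernelG r.ρ β H ζ with hγ
  haveI hγP : IsProbabilityMeasure γ := by
    rw [hγ]; unfold boxKernelG; exact isProbabilityMeasure_ymSpecification _ r.continuous _ _ _
  set W : Site 4 → LGConfig 4 G → ℝ := fun y U =>
    wilsonLoopObs (fun g : G => (r.N : ℝ)⁻¹ * (r.ρ g).trace.re) (rectWalk y 1 2 R R) U with hW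
  set Fb : Fin (dimE r.ρ) → Site 4 → ℝ := fun c z =>
    sCirc (glue (pin := fun e => e ∉ dirFreeEdges H) dirCorner (2 * H + 3) (ϑ c)
      (mean (fun e => e ∉ dirFreeEdges H) dirCorner (2 * H + 3) (ϑ c))) (z, 1, 2) with hFb
  set Ec : Fin (dimE r.ρ) → ℝ := fun c => formM (fun e => e ∉ dirFreeEdges H) dirCorner (2 * H + 3) (ϑ c) (s c) with hEc
  set V : Site 4 → ℝ := fun y => ∑ p ∈ rectSurface y R R, ∑ q ∈ rectSurface y R R,
    boxDirProjKernel H (p.1, 1, 2) (q.1, 1, 2) with hV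
  set Em : Site 4 → ℝ := fun y => ∫ U, W y U ∂γ with hEm
  have hEc0 : ∀ c, 0 ≤ Ec c := fun c => by
    rw [hEc]; simp only [LatticeMaxwell.formM]; exact Finset.sum_nonneg fun p _ => sq_nonneg _
  -- the two integrals as sums over the loops of the cube (`SoftLoopLongLagLoopTranslation`, seat sll-p4)
  have hF0 : ∫ U, softLoopObs r R (configShift (-boxCentre H) U) ∂γ = ∑ x ∈ timeZeroCube R, Em (x + boxCentre H) :=
    integral_softLoopObs_configShift_neg r R (boxCentre H) γ
  have hFT : ∫ U, softLoopObs r R (configShift (-boxCentre H) (timeShiftLG (G := G) R U)) ∂γ =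
      ∑ x ∈ timeZeroCube R, Em (x + boxCentre H + Pi.single 0 (R : ℤ)) :=
    integral_softLoopObs_configShift_neg_timeShiftLG r R R (boxCentre H) γ
  rw [hFT, hF0, ← Finset.sum_sub_distrib]
  have hRHS0 : 0 ≤ 27 * (4 + K + 1250 * C ^ 2) * ((dimE r.ρ : ℝ) + 1) * (|CE| + 1) * (R : ℝ) ^ 8 * β ^ (κ - 1) / (H : ℝ) := by
    positivity
  -- the case `N = 0` is trivial: every Wilson loop observable vanishes
  rcases Nat.eq_zero_or_pos r.N with hN | hN
  · have hEm0 : ∀ y, Em y = 0 := fun y => by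
      rw [hEm]
      have : ∀ U, W y U = 0 := fun U => by
        rw [hW]; simp only [wilsonLoopObs, hN, Nat.cast_zero, inv_zero, zero_mul]
      simp only [this, integral_zero]
    simp only [hEm0, sub_self, Finset.sum_const_zero, abs_zero]
    exact hRHS0
  -- sizes
  have hgeo : (2 * (H : ℝ) + 3) ^ 4 ≤ 625 * (H : ℝ) ^ 4 := two_mul_add_three_pow_four_le hH1
  have hβκ : 0 < β ^ (κ - 1) := Real.rpow_pos_of_pos hβ0 _
  have hEsum : ∑ c, Ec c ≤ |CE| * (625 * (H : ℝ) ^ 4) * β ^ (κ - 1) :=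
    calc ∑ c, Ec c ≤ CE * (2 * (H : ℝ) + 3) ^ 4 * β ^ (κ - 1) := henergy
      _ ≤ |CE| * (2 * (H : ℝ) + 3) ^ 4 * β ^ (κ - 1) := by gcongr; exact le_abs_self CE
      _ ≤ |CE| * (625 * (H : ℝ) ^ 4) * β ^ (κ - 1) := by gcongr
  -- the expansion in this file's dress: loop cost mean `= N − N·Em`, surface plaquettes as `(p.1, 1, 2)`
  have hFb_d₁ : ∀ c z, Fb c z = d₁ (fun z' (i : Fin 4) =>
      LatticeMaxwell.glue (pin := fun e => e ∉ dirFreeEdges H) dirCorner (2 * H + 3) (ϑ c)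
        (LatticeMaxwell.mean (fun e => e ∉ dirFreeEdges H) dirCorner (2 * H + 3) (ϑ c)) (z', i))
        z 1 2 := fun c z => by rw [hFb]; exact sCirc_eq_d₁ _ _
  have hpt' : ∀ y : Site 4, ‖y - boxCentre H‖ + R ≤ (H : ℝ) / 8 →
      |β * ((r.N : ℝ) - (r.N : ℝ) * Em y) - (dimE r.ρ : ℝ) / 2 * V y - β * ∑ c, (∑ p ∈ rectSurface y R R, Fb c p.1) ^ 2| ≤
        β ^ (-a) := by
    intro y hy
    have h := hpt y hy
    have hcost : ∫ U, ((r.N : ℝ) - (r.ρ (walkHolonomy U (rectWalk y 1 2 R R))).trace.re) ∂γ = (r.N : ℝ) - (r.N : ℝ) * Em y := by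
      have := integral_wilsonLoopObs_eq_cost r hN y R R γ
      rw [hEm]
      linarith
    have hVy : ∑ p ∈ rectSurface y R R, ∑ q ∈ rectSurface y R R,
        boxDirProjKernel H ((p.1, p.2.1.1, p.2.1.2) : Plaq 4) ((q.1, q.2.1.1, q.2.1.2) : Plaq 4) = V y := by
      rw [hV]
      exact Finset.sum_congr rfl fun p hp => Finset.sum_congr rfl fun q hq => by
        rw [plaq_eq_of_mem_rectSurface hp, plaq_eq_of_mem_rectSurface hq]
    have hBy : ∀ c, ∑ p ∈ rectSurface y R R,
        sCirc (LatticeMaxwell.glue (pin := fun e => e ∉ dirFreeEdges H) dirCorner (2 * H + 3)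
          (ϑ c) (mean (fun e => e ∉ dirFreeEdges H) dirCorner (2 * H + 3) (ϑ c))) ((p.1, p.2.1.1, p.2.1.2) : Plaq 4) =
        ∑ p ∈ rectSurface y R R, Fb c p.1 := fun c =>
      Finset.sum_congr rfl fun p hp => by rw [plaq_eq_of_mem_rectSurface hp]
    rw [hcost, hVy] at h
    simp_rw [hBy] at h
    exact h
  -- the per-loop bound (abstract lemma `perLoop_meanDiff_le`)
  have hloop : ∀ x ∈ timeZeroCube R,
      (r.N : ℝ) * |Em (x + boxCentre H + Pi.single 0 (R : ℤ)) - Em (x + boxCentre H)| ≤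
        (4 + K + 1250 * C ^ 2) * ((dimE r.ρ : ℝ) + 1) * (|CE| + 1) * ((R : ℝ) ^ 5 * β ^ (κ - 1) / (H : ℝ)) :=
    fun x hx => perLoop_meanDiff_le Em V Fb Ec hβ1 hκ hK0 (Nat.cast_nonneg r.N) hR1 hH1 hH2 h24 hEc0 hEsum hpt'
      (fun y v hy hyv => hK H hH32 R y v hy hyv)
      (fun c z hz => by rw [hFb_d₁]; exact (hI H hH8 (ϑ c) (s c) z hz 1 2).1)
      (fun c z hz => by rw [hFb_d₁, hFb_d₁]; exact (hI H hH8 (ϑ c) (s c) z hz 1 2).2 0) hx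
  clear_value Em W Fb Ec V γ
  clear hpt hpt' hFb_d₁ hF0 hFT
  -- sum over the loops of the cube and divide by `N ≥ 1`
  have hRnat : 1 ≤ R := by exact_mod_cast hR1
  have hcard : ((timeZeroCube R).card : ℝ) ≤ 27 * (R : ℝ) ^ 3 := card_timeZeroCube_le_real hRnat
  set Q : ℝ := (4 + K + 1250 * C ^ 2) * ((dimE r.ρ : ℝ) + 1) * (|CE| + 1) * ((R : ℝ) ^ 5 * β ^ (κ - 1) / (H : ℝ)) with hQ
  have hQ0 : 0 ≤ Q := by rw [hQ]; positivity
  have hsumN : (r.N : ℝ) * |∑ x ∈ timeZeroCube R, (Em (x + boxCentre H + Pi.single 0 (R : ℤ)) - Em (x + boxCentre H))| ≤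
      27 * (R : ℝ) ^ 3 * Q := by
    have habs := Finset.abs_sum_le_sum_abs (fun x => Em (x + boxCentre H + Pi.single 0 (R : ℤ)) - Em (x + boxCentre H))
      (timeZeroCube R)
    have h1 := mul_le_mul_of_nonneg_left habs (Nat.cast_nonneg r.N : (0 : ℝ) ≤ r.N)
    refine h1.trans ?_
    rw [Finset.mul_sum]
    refine (Finset.sum_le_sum hloop).trans ?_
    rw [Finset.sum_const, nsmul_eq_mul]
    exact mul_le_mul_of_nonneg_right hcard hQ0
  have hfinal : 27 * (R : ℝ) ^ 3 * Q =
      27 * (4 + K + 1250 * C ^ 2) * ((dimE r.ρ : ℝ) + 1) * (|CE| + 1) * (R : ℝ) ^ 8 * β ^ (κ - 1) / (H : ℝ) := by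
    rw [hQ]; ring
  rw [← hfinal]
  have hN1 : (1 : ℝ) ≤ r.N := by exact_mod_cast hN
  exact (le_mul_of_one_le_left (abs_nonneg _) hN1).trans hsumN

/-- **The REGISTERED E2 from a UNIFORM loop kernel-mean expansion.**  If N2-loops (interface of `SoftLoopLongLagInnerMeanSmoothOfExpansionG`,
`Good` = crude-good at `κ/2` ∧ inner hot mass `≤ e^{−β^{κ/8}}`, `b = a`, `δ = κ/2`) holds for `(G, r)` with ONE energy constant `CE` along all
exponents `0 < ε`, `4ε ≤ a ≤ a₂`, `0 < κ ≤ κ₂` (the quantifier shape of `ColdBoxAllGroups.KernelMeanExpansionG` along a family), then the body of the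
registered stub `stub_innerDatumMeanSmoothG` (K′ skeleton v5 = T′ skeleton v6, the shared E2) holds for `(G, r)` with the uniform constants
`K = K₀·(D+1)·(|CE|+1)`, `a₂`, `κ₂`.  One line from `innerMeanSmoothLoopG_of_loopMeanExpansion`; complements the width seat sll-p4's
`innerDatumMeanSmoothG_of_loopMeanExpansion` (same interface with a general `Good`, constant `K` existential per exponent triple). [folklore] -/
theorem innerDatumMeanSmoothG_registered_of_loopMeanExpansion
    (G : Type) [Group G] [TopologicalSpace G] [IsTopologicalGroup G] [CompactSpace G] [MeasurableSpace G] [BorelSpace G]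
    (r : LatticeRep G)
    (hexp : ∃ CE a₂ κ₂ : ℝ, 0 < a₂ ∧ 0 < κ₂ ∧ ∀ ε a κ : ℝ, 0 < ε → 4 * ε ≤ a → a ≤ a₂ → 0 < κ → κ ≤ κ₂ →
      ∃ β₀ : ℝ, ∀ β : ℝ, β₀ ≤ β → ∀ ζ : LGConfig 4 G, CrudeGoodG r.ρ β (κ / 2) ⌈β ^ a⌉₊ ζ →
          boxKernelG r.ρ β ⌈β ^ a⌉₊ ζ (coldEvent r β κ (AxialGauge.boxEdges 4 (2 * ⌈β ^ a⌉₊ + 1)))ᶜ ≤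
            ENNReal.ofReal (Real.exp (-(β ^ (κ / 8)))) →
          ∃ ϑ : Fin (dimE r.ρ) → (Literature.MathematicalPhysics.QuantumLattice.ZdEdge 4 → ℝ),
          ∃ s : Fin (dimE r.ρ) → (DirFree ⌈β ^ a⌉₊ → ℝ),
            (∑ c, formM (fun e => e ∉ dirFreeEdges ⌈β ^ a⌉₊) dirCorner (2 * ⌈β ^ a⌉₊ + 3) (ϑ c) (s c) ≤
                CE * (2 * (⌈β ^ a⌉₊ : ℝ) + 3) ^ 4 * β ^ (2 * (κ / 2) - 1)) ∧
            ∀ x : Site 4, ‖x - boxCentre ⌈β ^ a⌉₊‖ + ⌈β ^ ε⌉₊ ≤ (⌈β ^ a⌉₊ : ℝ) / 8 →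
              |β * (∫ U, ((r.N : ℝ) - (r.ρ (walkHolonomy U (rectWalk x 1 2 ⌈β ^ ε⌉₊ ⌈β ^ ε⌉₊))).trace.re)
                    ∂(boxKernelG r.ρ β ⌈β ^ a⌉₊ ζ)) -
                  (dimE r.ρ : ℝ) / 2 * (∑ p ∈ rectSurface x ⌈β ^ ε⌉₊ ⌈β ^ ε⌉₊, ∑ q ∈ rectSurface x ⌈β ^ ε⌉₊ ⌈β ^ ε⌉₊,
                    boxDirProjKernel ⌈β ^ a⌉₊ ((p.1, p.2.1.1, p.2.1.2) : Plaq 4) ((q.1, q.2.1.1, q.2.1.2) : Plaq 4)) -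
                  β * ∑ c, (∑ p ∈ rectSurface x ⌈β ^ ε⌉₊ ⌈β ^ ε⌉₊,
                    sCirc (LatticeMaxwell.glue (pin := fun e => e ∉ dirFreeEdges ⌈β ^ a⌉₊) dirCorner (2 * ⌈β ^ a⌉₊ + 3)
                      (ϑ c) (mean (fun e => e ∉ dirFreeEdges ⌈β ^ a⌉₊) dirCorner (2 * ⌈β ^ a⌉₊ + 3) (ϑ c)))
                      ((p.1, p.2.1.1, p.2.1.2) : Plaq 4)) ^ 2| ≤ β ^ (-a)) :
    ∃ K a₂ κ₂ : ℝ, 0 < K ∧ 0 < a₂ ∧ 0 < κ₂ ∧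
      ∀ ε a κ : ℝ, 0 < ε → 4 * ε ≤ a → a ≤ a₂ → 0 < κ → κ ≤ κ₂ → ∃ β₀ : ℝ,
        ∀ β : ℝ, β₀ ≤ β → ∀ ζ : LGConfig 4 G,
          CrudeGoodG r.ρ β (κ / 2) ⌈β ^ a⌉₊ ζ →
          boxKernelG r.ρ β ⌈β ^ a⌉₊ ζ (coldEvent r β κ (AxialGauge.boxEdges 4 (2 * ⌈β ^ a⌉₊ + 1)))ᶜ ≤
            ENNReal.ofReal (Real.exp (-(β ^ (κ / 8)))) →
          |(∫ U, softLoopObs r ⌈β ^ ε⌉₊ (configShift (-(boxCentre ⌈β ^ a⌉₊)) (timeShiftLG (G := G) ⌈β ^ ε⌉₊ U))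
                ∂(boxKernelG r.ρ β ⌈β ^ a⌉₊ ζ)) -
              ∫ U, softLoopObs r ⌈β ^ ε⌉₊ (configShift (-(boxCentre ⌈β ^ a⌉₊)) U) ∂(boxKernelG r.ρ β ⌈β ^ a⌉₊ ζ)| ≤
            K * (⌈β ^ ε⌉₊ : ℝ) ^ 8 * β ^ (κ - 1) / (⌈β ^ a⌉₊ : ℝ) := by
  obtain ⟨K₀, hK₀, hmain⟩ := innerMeanSmoothLoopG_of_loopMeanExpansion
  obtain ⟨CE, a₂, κ₂, ha₂, hκ₂, hE⟩ := hexp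
  refine ⟨K₀ * ((dimE r.ρ : ℝ) + 1) * (|CE| + 1), a₂, κ₂, by positivity, ha₂, hκ₂, fun ε a κ hε h4 ha hκ hκle => ?_⟩
  have hεa : ε < a := by linarith
  exact hmain G r ε a κ CE hε hεa hκ (hE ε a κ hε h4 ha hκ hκle)

end Reduction

end Summit.QuantumFields.YangMills.Theorems.SoftLoopLongLag

end
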